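import Literature.NumberTheory.EllipticCurves.AbelianVarietyBridgeFullProofs
import Literature.AlgebraicGeometry.Motives.AbelianVarietyExistence
import Literature.AlgebraicGeometry.Motives.AbelianVarietyRigidity
import Literature.AlgebraicGeometry.Motives.AlgPointsSeparate
import Literature.AlgebraicGeometry.Motives.DworkFamily
import Mathlib.AlgebraicGeometry.EllipticCurve.ModelsWithJ
import HarnessLib

/-!
# The automorphism `[ω] : (x, y) ↦ (ωx, y)` of `y² + y = x³` as an endomorphism of the abelian variety

Topic `Literature/NumberTheory/EllipticCurves` (namespace `Literature.NumberTheory.EllipticCurves`,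
sub-namespace `J0` for the curve `y² + y = x³` of `j`-invariant `0`, Mathlib's `WeierstrassCurve.ofJ0`).
Sibling of `J1728MulI` (`[i] : (x, y) ↦ (-x, iy)` on `y² = x³ + x`), built by the same device, for the
SECOND classical curve with complex multiplication.  Silverman, *The Arithmetic of Elliptic Curves*,
III.10.1 (held copy, PDF p. 96–97): for `j(E) = 0` and `char K ≠ 2, 3` the automorphism group of `E`
is `μ₆`, acting by the substitutions `x = u²x′`, `y = u³y′`, `u⁶ = 1`; for `u³ = 1`, `u² = ω` a
primitive cube root of unity, this is `[ω] : (x, y) ↦ (ωx, y)` — on the model `y² + y = x³` (`a₃ = 1`,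
all other `aᵢ = 0`; `Δ = -27`) the substitution visibly preserves the equation since `(ωx)³ = x³`
(Hartshorne, *Algebraic Geometry*, IV Example 4.20.2: «the curve `y² = x³ + 1` … has an automorphism of
order `3` … `x ↦ ωx`», and IV Ex. 4.6).  It is DEFINED OVER `K` as soon as `ω ∈ K`.  This file constructs
`[ω]` on the tree's REAL carrier — the plane cubic `E′ = V₊(Y²Z + YZ² - X³) ⊂ ℙ²_K` with the chord–tangent
group law as a `K`-group scheme (`WeierstrassCurve.abelianVarietyOfAddHom` of
`EllipticCurves/AbelianVarietyModelOfAddHom`, assembled unconditionally in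
`EllipticCurves/AbelianVarietyBridgeFullProofs`):

* `J0.abelianVariety K` — `E′ : y² + y = x³` as an `AbelianVariety K` (`3 ∈ Kˣ`);
* `J0.mulOmegaVec ω = (ω, 1, 1)` and the invariance of the Weierstrass form `Y²Z + YZ² - X³` under the
  diagonal substitution `(X, Y, Z) ↦ (ωX, Y, Z)` (`aeval_diagSubst_mulOmegaVec_polynomial`, `ω³ = 1`);
* `J0.mulOmegaOver hω : E′ ⟶ E′` — the restriction to `E′ ⊂ ℙ²_K` of the diagonal projective
  transformation `diag(ω, 1, 1)` (the tree's `SmoothHypersurface.substLift`, Hartshorne II Ex. 3.11 (d)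
  / Example 7.1.1), with its action on homogeneous coordinates (`map_mulOmegaOver_schemePoint`); it fixes
  `O = [0 : 1 : 0]` (`oneHom_comp_mulOmegaOver`), hence is a HOMOMORPHISM of group schemes by rigidity
  (Mumford, *Abelian Varieties* §4 Cor. 1 = the tree's `isMonHom_of_one_comp`);
* `J0.mulOmega hω : abelianVariety K ⟶ abelianVariety K` — `[ω]` as an endomorphism of the abelian
  variety, with **`mulOmega_comp_mulOmega_comp_mulOmega : [ω] ≫ [ω] ≫ [ω] = 𝟙`** (`ω³ = 1`; checked on
  `K̄`-points, which separate morphisms out of a reduced `K`-scheme of finite type,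
  `SchemeOver.hom_ext_of_forall_algPoints`);
* **`J0.mulOmega_comp_mulOmega_add : [ω] ≫ [ω] + [ω] + 𝟙 = 0` in `End_K(E′)`** — this is NOT an identity
  of projective substitutions: it is proved on `K̄`-points through the ADDITIVE dictionary
  `E′(K̄) ≃+ W(K̄)` of the model (`WeierstrassCurve.geomPointsEquivOfAddHom`) and the faithfulness of
  `f ↦ f(K̄)` (`AbelianVariety.eq_zero_of_geomPointsMap_eq_zero`, Mumford §4), by the chord–tangent law
  (Silverman, *AEC* III.2.3): the three points `(x, y)`, `(ωx, y)`, `(ω²x, y)` are the intersection of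
  `E′` with the line `Y = yZ`, so they sum to `O` (`Affine.Point.some_add_some_add_some_eq_zero_of_cube`;
  for `x = 0` the flexes `(0, 0)`, `(0, -1)` are `3`-torsion points);
* `aeval_mulOmega_X_sq_add_X_add_one : (X² + X + 1)([ω]) = 0` in `End E′`, i.e. `Φ₃([ω]) = 0` — the form
  consumed by the CM-type realisation over `ℚ(ζ₃)` (`ℤ[ζ₃] → End_K(E′)`, `ζ₃ ↦ [ω]`).

Everything is a definition with a body or a theorem; no named fact is introduced (D-0026).
Templates: `EllipticCurves/J1728MulI` (`J1728.mulI`), `HodgeTheory/EisensteinCurveSqrtMinusThree`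
(`WeilSquare.rot`: the same automorphism on the analytic Eisenstein curve `ℂ/(ℤ + ωℤ)` over `ℂ`).

## References

* [SilvermanAEC2009] J. H. Silverman, *The Arithmetic of Elliptic Curves*, 2nd ed., GTM 106 (2009):
  III.10.1 and Cor. 10.2 (automorphisms `(x, y) ↦ (u²x, u³y)`, `u⁶ = 1` for `j = 0`), III.2.3 (group law:
  three collinear points sum to `O`), III.3.6, App. C §11 Example 11.3.1 (`j = 0`: CM by `ℤ[ω]`).
* [Hartshorne1977] R. Hartshorne, *Algebraic Geometry* (1977), II Ex. 2.14, II Ex. 3.11 (d),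
  II Example 7.1.1; IV Example 4.20.2 and Ex. 4.6 (the automorphism `x ↦ ωx` of order `3` for `j = 0`).
* [MumfordAV1970] D. Mumford, *Abelian Varieties* (1970), §4 (rigidity; Cor. 1), §19.
-/

noncomputable section

open CategoryTheory AlgebraicGeometry MonoidalCategory CartesianMonoidalCategory MvPolynomial
open scoped MonObj
open Literature.AlgebraicGeometry.Motives
open WeierstrassCurve (ofJ0)

universe u

namespace Literature.NumberTheory.EllipticCurves

namespace J0

variable (K : Type u) [Field K]

attribute [local instance] MvPolynomial.gradedAlgebra ProjBaseChange.algebraBase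

/-! ### The curve `E′ : y² + y = x³` as an abelian variety over `K` -/

section AV

variable [Fact (IsUnit (3 : K))]

/-- **`E′ : y² + y = x³` as an abelian variety over `K`** (`3 ∈ Kˣ`, so that `Δ = -27 ≠ 0`): the smooth
plane cubic of Mathlib's `WeierstrassCurve.ofJ0 K` with the chord–tangent addition morphism and the
negation morphism (the tree's `abelianVarietyOfAddHom`; Silverman, *AEC* III.3.6).
[cite: SilvermanAEC2009, III.3.6] -/
def abelianVariety : AbelianVariety K :=
  (ofJ0 K).abelianVarietyOfAddHom (ofJ0 K).addHom (ofJ0 K).negHom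
    (ofJ0 K).lift_pointEquiv_comp_addHom (ofJ0 K).pointEquiv_comp_negHom_geom

/-- The underlying `K`-scheme of `E′` is the Weierstrass plane cubic of `ofJ0 K` (`rfl`).
[cite: SilvermanAEC2009, III.3.1(c)] -/
theorem abelianVariety_X : (abelianVariety K).X = (ofJ0 K).scheme := rfl

/-- `dim E′ = 1`. [cite: SilvermanAEC2009, III.3.1(c)] -/
theorem dim_abelianVariety : (abelianVariety K).dim = 1 :=
  dim_abelianVarietyOfAddHom (ofJ0 K) _ _ _ _

/-- The unit of the group scheme `E′` is the section `O = [0 : 1 : 0]` (`rfl`). [cite: SilvermanAEC2009, III.2] -/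
theorem one_eq_oneHom : η[(abelianVariety K).X] = (ofJ0 K).oneHom := rfl

/-- **The dictionary of geometric points `E′(K̄) ≃+ W(K̄)`** between the `K̄`-points of the group scheme
`E′` and Mathlib's group of points of `y² + y = x³` over `K̄` (additive: the group law of `E′` IS the
chord–tangent law; `WeierstrassCurve.geomPointsEquivOfAddHom`). [cite: SilvermanAEC2009, III.2 and III.3.6] -/
def geomPointsEquiv : (abelianVariety K).geomPoints ≃+ (ofJ0 K).geomPoints :=
  (ofJ0 K).geomPointsEquivOfAddHom (ofJ0 K).addHom (ofJ0 K).negHom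
    (ofJ0 K).lift_pointEquiv_comp_addHom (ofJ0 K).pointEquiv_comp_negHom_geom

/-- `geomPointsEquiv P = pointEquiv⁻¹ P` (the dictionary `E′(K̄) = W(K̄)`). [cite: SilvermanAEC2009, III.2 and III.3.6] -/
theorem geomPointsEquiv_apply (P : (abelianVariety K).geomPoints) :
    geomPointsEquiv K P = (ofJ0 K).toGeomPoint (Additive.toMul P) :=
  WeierstrassCurve.geomPointsEquivOfAddHom_apply _ _ _ _ _ P

/-- The geometric point `[x : y : 1]` (resp. `O`) of `E′` attached to a point `Q = (x, y)` (resp. `O`) of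
Mathlib's `W(K̄)`: `pointEquiv Q`, read in the additive group `E′(K̄)`. [cite: SilvermanAEC2009, III.2] -/
def ofAffinePoint (Q : ((ofJ0 K).baseChange (AlgebraicClosure K)).toAffine.Point) :
    (abelianVariety K).geomPoints :=
  Additive.ofMul ((ofJ0 K).pointEquiv (L := AlgebraicClosure K) Q)

/-- `toMul (ofAffinePoint Q) = pointEquiv Q` (`rfl`). [folklore] -/
private theorem toMul_ofAffinePoint (Q : ((ofJ0 K).baseChange (AlgebraicClosure K)).toAffine.Point) :
    Additive.toMul (ofAffinePoint K Q) = (ofJ0 K).pointEquiv (L := AlgebraicClosure K) Q := rfl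

/-- `ofAffinePoint` is injective. [folklore] -/
private theorem ofAffinePoint_injective : Function.Injective (ofAffinePoint K) := fun _ _ h =>
  ((ofJ0 K).pointEquiv (L := AlgebraicClosure K)).injective (congrArg Additive.toMul h)

/-- Every geometric point of `E′` is `ofAffinePoint Q` for a (unique) `Q ∈ W(K̄)`. [cite: SilvermanAEC2009, III.2] -/
theorem exists_eq_ofAffinePoint (P : (abelianVariety K).geomPoints) :
    ∃ Q : ((ofJ0 K).baseChange (AlgebraicClosure K)).toAffine.Point, P = ofAffinePoint K Q := by
  obtain ⟨Q, hQ⟩ := ((ofJ0 K).pointEquiv (L := AlgebraicClosure K)).surjective (Additive.toMul P)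
  exact ⟨Q, congrArg Additive.ofMul hQ.symm⟩

/-- `geomPointsEquiv (ofAffinePoint Q) = Q`: the dictionary `E′(K̄) ≃+ W(K̄)` inverts `pointEquiv`.
[cite: SilvermanAEC2009, III.2 and III.3.6] -/
theorem geomPointsEquiv_ofAffinePoint (Q : ((ofJ0 K).baseChange (AlgebraicClosure K)).toAffine.Point) :
    geomPointsEquiv K (ofAffinePoint K Q) = Q := by
  rw [geomPointsEquiv_apply]
  exact (ofJ0 K).toGeomPoint_pointEquiv Q

end AV

/-! ### The diagonal substitution `(X, Y, Z) ↦ (ωX, Y, Z)` fixes `Y²Z + YZ² - X³` -/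

variable {K}

/-- The scaling vector `(ω, 1, 1)` of the substitution `(X, Y, Z) ↦ (ωX, Y, Z)`, Silverman's
`[ω] : (x, y) ↦ (ωx, y)` (`u² = ω`, `u³ = 1`). [cite: SilvermanAEC2009, III.10.1] -/
def mulOmegaVec (ω : K) : Fin 3 → K := ![ω, 1, 1]

/-- `(ω, 1, 1)₀ = ω`. [folklore] -/
@[simp] private theorem mulOmegaVec_zero (ω : K) : mulOmegaVec ω 0 = ω := rfl

/-- `(ω, 1, 1)₁ = 1`. [folklore] -/
@[simp] private theorem mulOmegaVec_one (ω : K) : mulOmegaVec ω 1 = 1 := rfl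

/-- `(ω, 1, 1)₂ = 1`. [folklore] -/
@[simp] private theorem mulOmegaVec_two (ω : K) : mulOmegaVec ω 2 = 1 := rfl

/-- `ω³ = 1` when `ω² + ω + 1 = 0` (`ω³ - 1 = (ω - 1)(ω² + ω + 1)`). [folklore] -/
private theorem pow_three_eq_one_of_sq_add_self_add_one {R : Type*} [CommRing R] {ω : R}
    (hω : ω ^ 2 + ω + 1 = 0) : ω ^ 3 = 1 := by
  linear_combination (ω - 1) * hω

/-- `ω ≠ 0` when `ω² + ω + 1 = 0` (else `1 = 0`). [folklore] -/
private theorem ne_zero_of_sq_add_self_add_one {R : Type*} [CommRing R] [Nontrivial R] {ω : R}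
    (hω : ω ^ 2 + ω + 1 = 0) : ω ≠ 0 := fun h => by
  rw [h] at hω
  norm_num at hω

/-- `ω ≠ 1` when `ω² + ω + 1 = 0` and `3 ≠ 0` (else `3 = 0`). [folklore] -/
private theorem ne_one_of_sq_add_self_add_one {R : Type*} [CommRing R] {ω : R} (h3 : (3 : R) ≠ 0)
    (hω : ω ^ 2 + ω + 1 = 0) : ω ≠ 1 := fun h => by
  rw [h] at hω
  norm_num at hω
  exact h3 hω

/-- The entries of `(ω, 1, 1)` are non-zero. [cite: SilvermanAEC2009, III.10.1] -/
theorem mulOmegaVec_ne_zero {ω : K} (hω : ω ^ 2 + ω + 1 = 0) (j : Fin 3) : mulOmegaVec ω j ≠ 0 := by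
  fin_cases j
  · exact ne_zero_of_sq_add_self_add_one hω
  · exact one_ne_zero
  · exact one_ne_zero

/-- Scaling a vector by `(ω, 1, 1)`: `(x, y, z) ↦ (ωx, y, z)`, Silverman's `(x, y) ↦ (ωx, y)`.
[cite: SilvermanAEC2009, III.10.1] -/
theorem mulOmegaVec_mul_apply {L : Type u} [Field L] [Algebra K L] (ω : K) (v : Fin 3 → L) :
    (fun j => algebraMap K L (mulOmegaVec ω j) * v j) = ![algebraMap K L ω * v 0, v 1, v 2] := by
  funext j
  fin_cases j <;> simp

/-- Scaling three times by `(ω, 1, 1)` is the identity (`ω³ = 1`). [cite: SilvermanAEC2009, III.10.1] -/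
theorem mulOmegaVec_mul_mulOmegaVec_mul_mulOmegaVec_mul_apply {L : Type u} [Field L] [Algebra K L] {ω : K}
    (hω : ω ^ 2 + ω + 1 = 0) (v : Fin 3 → L) :
    (fun j => algebraMap K L (mulOmegaVec ω j) *
      (algebraMap K L (mulOmegaVec ω j) * (algebraMap K L (mulOmegaVec ω j) * v j))) = v := by
  have h3 : algebraMap K L ω * (algebraMap K L ω * algebraMap K L ω) = 1 := by
    rw [← map_mul, ← map_mul, ← map_one (algebraMap K L)]
    congr 1
    linear_combination pow_three_eq_one_of_sq_add_self_add_one hω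
  funext j
  fin_cases j
  · simp only [mulOmegaVec_zero, Fin.zero_eta]
    linear_combination (v 0) * h3
  · simp
  · simp

/-- **The Weierstrass form `Y²Z + YZ² - X³` of `y² + y = x³` is invariant under `(X, Y, Z) ↦ (ωX, Y, Z)`**
(`ω³ = 1` on `X³`; all other monomials do not involve `X`). [cite: SilvermanAEC2009, III.10.1]
[cite: Hartshorne1977, IV Example 4.20.2] -/
theorem aeval_diagSubst_mulOmegaVec_polynomial {ω : K} (hω : ω ^ 2 + ω + 1 = 0) :
    aeval (ProjectiveSpace.diagSubst (mulOmegaVec ω)) (ofJ0 K).toProjective.polynomial =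
      (ofJ0 K).toProjective.polynomial := by
  have hX : ∀ j : Fin 3, aeval (ProjectiveSpace.diagSubst (mulOmegaVec ω)) (X j : MvPolynomial (Fin 3) K) =
      C (mulOmegaVec ω j) * X j := fun j => by
    rw [aeval_X, ProjectiveSpace.diagSubst_apply]
  have ha₁ : (ofJ0 K).toProjective.a₁ = 0 := rfl
  have ha₂ : (ofJ0 K).toProjective.a₂ = 0 := rfl
  have ha₃ : (ofJ0 K).toProjective.a₃ = 1 := rfl
  have ha₄ : (ofJ0 K).toProjective.a₄ = 0 := rfl
  have ha₆ : (ofJ0 K).toProjective.a₆ = 0 := rfl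
  simp only [WeierstrassCurve.Projective.polynomial, map_sub, map_add, map_mul, map_pow, hX,
    mulOmegaVec_zero, mulOmegaVec_one, mulOmegaVec_two, one_mul, ha₁, ha₂, ha₃, ha₄, ha₆, C_0, C_1,
    zero_mul, add_zero]
  have hC : (C ω : MvPolynomial (Fin 3) K) ^ 3 = 1 := by
    rw [← C_pow, pow_three_eq_one_of_sq_add_self_add_one hω, C_1]
  linear_combination (-(X 0 : MvPolynomial (Fin 3) K) ^ 3) * hC

/-! ### The morphism `[ω] : E′ ⟶ E′` of `K`-schemes -/

section Scheme

variable {ω : K} (hω : ω ^ 2 + ω + 1 = 0)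

include hω

/-- **`[ω]` as a `K`-morphism of schemes `E′ ⟶ E′`**: the restriction to the cubic `E′ ⊂ ℙ²_K` of the
diagonal projective transformation `[X : Y : Z] ↦ [ωX : Y : Z]` (which fixes its equation), through the
reduced induced structure. [cite: Hartshorne1977, II Ex. 3.11 (d) and Example 7.1.1]
[cite: SilvermanAEC2009, III.10.1] -/
def mulOmegaOver : (ofJ0 K).scheme ⟶ (ofJ0 K).scheme :=
  SmoothHypersurface.substLift (n := 1) (ofJ0 K).toProjective.polynomial
    (ProjectiveSpace.diagSubst (mulOmegaVec ω)) (ProjectiveSpace.isHomogeneous_diagSubst _)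
    (ProjectiveSpace.diagSubst fun j => (mulOmegaVec ω j)⁻¹) (ProjectiveSpace.isHomogeneous_diagSubst _)
    (ProjectiveSpace.aeval_diagSubst_diagSubst_inv (mulOmegaVec_ne_zero hω))
    (aeval_diagSubst_mulOmegaVec_polynomial hω)

/-- `[ω]` is the restriction of `diag(ω, 1, 1)`: `mulOmegaOver ≫ ι = ι ≫ diagMap`. [cite: Hartshorne1977, II Ex. 3.11 (d)] -/
theorem mulOmegaOver_comp_schemeι :
    mulOmegaOver hω ≫ (ofJ0 K).schemeι =
      (ofJ0 K).schemeι ≫ ProjectiveSpace.diagMap (mulOmegaVec ω) (mulOmegaVec_ne_zero hω) :=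
  SmoothHypersurface.substLift_comp_hypersurfaceι _ _ _ _ _ _ _

variable {L : Type u} [Field L] [Algebra K L]

/-- Scaling a solution of the Weierstrass equation of `E′` by `(ω, 1, 1)` gives a solution (the
substitution `x = u²x′, y = u³y′`, `u³ = 1`, preserves `y² + y = x³`). [cite: SilvermanAEC2009, III.10.1] -/
theorem equation_mulOmegaVec_mul {v : Fin 3 → L} (hv : ((ofJ0 K).baseChange L).toProjective.Equation v) :
    ((ofJ0 K).baseChange L).toProjective.Equation fun j => algebraMap K L (mulOmegaVec ω j) * v j := by
  rw [← WeierstrassCurve.aeval_toProjective_polynomial_eq_zero_iff] at hv ⊢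
  rw [← ProjectiveSpace.substVec_diagSubst]
  change aeval (fun j => aeval v (ProjectiveSpace.diagSubst (mulOmegaVec ω) j)) _ = 0
  rw [← ProjectiveSpace.aeval_substGraded _ (ProjectiveSpace.isHomogeneous_diagSubst _),
    ProjectiveSpace.substGraded_apply, aeval_diagSubst_mulOmegaVec_polynomial hω, hv]

/-- A non-zero vector of homogeneous coordinates stays non-zero under scaling by `(ω, 1, 1)`.
[cite: SilvermanAEC2009, III.10.1] -/
theorem mulOmegaVec_mul_ne_zero {v : Fin 3 → L} (hv : v ≠ 0) :
    (fun j => algebraMap K L (mulOmegaVec ω j) * v j) ≠ 0 := by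
  intro h
  apply hv
  funext j
  have hj := congrFun h j
  simp only [Pi.zero_apply, mul_eq_zero] at hj
  exact hj.resolve_left (by
    rw [map_eq_zero_iff _ (algebraMap K L).injective]
    exact mulOmegaVec_ne_zero hω j)

/-- **`[ω]` on homogeneous coordinates: `[x : y : z] ↦ [ωx : y : z]`.**
[cite: Hartshorne1977, II Ex. 2.14] [cite: SilvermanAEC2009, III.10.1] -/
theorem map_mulOmegaOver_schemePoint (v : Fin 3 → L) (hv : v ≠ 0)
    (hEq : ((ofJ0 K).baseChange L).toProjective.Equation v) :
    AlgPoints.map (mulOmegaOver hω) ((ofJ0 K).schemePoint v hv hEq) =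
      (ofJ0 K).schemePoint (fun j => algebraMap K L (mulOmegaVec ω j) * v j)
        (mulOmegaVec_mul_ne_zero hω hv) (equation_mulOmegaVec_mul hω hEq) := by
  apply AlgPoints.map_injective_of_mono (ofJ0 K).schemeι
  rw [← AlgPoints.map_comp_apply, mulOmegaOver_comp_schemeι, AlgPoints.map_comp_apply,
    WeierstrassCurve.map_schemeι_schemePoint, WeierstrassCurve.map_schemeι_schemePoint, AlgPoints.map_apply,
    ProjectiveSpace.pointOfVec_comp_diagMap]

/-- `[v] ≫ [ω] = [ωx : y : z]` (the same, written with `≫`). [cite: SilvermanAEC2009, III.10.1] -/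
theorem schemePoint_comp_mulOmegaOver (v : Fin 3 → L) (hv : v ≠ 0)
    (hEq : ((ofJ0 K).baseChange L).toProjective.Equation v) :
    (ofJ0 K).schemePoint v hv hEq ≫ mulOmegaOver hω =
      (ofJ0 K).schemePoint (fun j => algebraMap K L (mulOmegaVec ω j) * v j)
        (mulOmegaVec_mul_ne_zero hω hv) (equation_mulOmegaVec_mul hω hEq) :=
  map_mulOmegaOver_schemePoint hω v hv hEq

/-- **`[ω] ≫ [ω] ≫ [ω]` on homogeneous coordinates is the identity** (`ω³ = 1`). [cite: SilvermanAEC2009, III.10.1] -/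
theorem schemePoint_comp_mulOmegaOver_comp_mulOmegaOver_comp_mulOmegaOver (v : Fin 3 → L) (hv : v ≠ 0)
    (hEq : ((ofJ0 K).baseChange L).toProjective.Equation v) :
    (((ofJ0 K).schemePoint v hv hEq ≫ mulOmegaOver hω) ≫ mulOmegaOver hω) ≫ mulOmegaOver hω =
      (ofJ0 K).schemePoint v hv hEq := by
  rw [schemePoint_comp_mulOmegaOver, schemePoint_comp_mulOmegaOver, schemePoint_comp_mulOmegaOver]
  exact WeierstrassCurve.schemePoint_congr _ (mulOmegaVec_mul_mulOmegaVec_mul_mulOmegaVec_mul_apply hω v)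
    _ _ _ _

/-- **`[ω]` fixes the origin `O = [0 : 1 : 0]`** (`[ω·0 : 1 : 0] = [0 : 1 : 0]`), as `K`-points.
[cite: SilvermanAEC2009, III.10.1] -/
theorem unitPoint_comp_mulOmegaOver : (ofJ0 K).unitPoint ≫ mulOmegaOver hω = (ofJ0 K).unitPoint := by
  rw [WeierstrassCurve.unitPoint, schemePoint_comp_mulOmegaOver]
  refine WeierstrassCurve.schemePoint_congr _ ?_ _ _ _ _
  funext j
  fin_cases j <;> simp

/-- **`[ω]` fixes the origin** (the unit section `oneHom : Spec K ⟶ E′`). [cite: SilvermanAEC2009, III.10.1] -/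
theorem oneHom_comp_mulOmegaOver : (ofJ0 K).oneHom ≫ mulOmegaOver hω = (ofJ0 K).oneHom := by
  ext : 1
  rw [Over.comp_left, WeierstrassCurve.oneHom_left]
  exact congrArg CommaMorphism.left (unitPoint_comp_mulOmegaOver hω)

/-- **`[ω]` on Mathlib's affine points: `pointEquiv (x, y) ≫ [ω] = pointEquiv (ωx, y)`.**
[cite: SilvermanAEC2009, III.10.1] -/
theorem map_mulOmegaOver_pointEquiv_some [(ofJ0 K).IsElliptic] {x y : L}
    (h : ((ofJ0 K).baseChange L).toAffine.Nonsingular x y)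
    (h' : ((ofJ0 K).baseChange L).toAffine.Nonsingular (algebraMap K L ω * x) y) :
    AlgPoints.map (mulOmegaOver hω) ((ofJ0 K).pointEquiv (WeierstrassCurve.Affine.Point.some x y h)) =
      (ofJ0 K).pointEquiv (WeierstrassCurve.Affine.Point.some _ _ h') := by
  rw [WeierstrassCurve.pointEquiv_some, WeierstrassCurve.pointEquiv_some, map_mulOmegaOver_schemePoint]
  refine WeierstrassCurve.schemePoint_congr _ ?_ _ _ _ _
  funext j
  fin_cases j <;> simp

/-- **`[ω]` fixes `O` on Mathlib's affine points: `pointEquiv O ≫ [ω] = pointEquiv O`.**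
[cite: SilvermanAEC2009, III.10.1] -/
theorem map_mulOmegaOver_pointEquiv_zero [(ofJ0 K).IsElliptic] :
    AlgPoints.map (mulOmegaOver hω) ((ofJ0 K).pointEquiv (0 : ((ofJ0 K).baseChange L).toAffine.Point)) =
      (ofJ0 K).pointEquiv (0 : ((ofJ0 K).baseChange L).toAffine.Point) := by
  rw [WeierstrassCurve.pointEquiv_zero, map_mulOmegaOver_schemePoint]
  refine WeierstrassCurve.schemePoint_congr _ ?_ _ _ _ _
  funext j
  fin_cases j <;> simp

end Scheme

/-! ### The chord–tangent computation: `(x, y) + (ωx, y) + (ω²x, y) = O` -/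

open scoped Classical in
/-- **Three points of `y² + a₃y = x³ + a₆` on a horizontal line sum to `O`.**  On a Weierstrass curve with
`a₁ = a₂ = a₄ = 0` and `ω² + ω + 1 = 0` (`char ≠ 3`), the points `(x, y)`, `(ωx, y)`, `(ω²x, y)` are the
three intersections of the curve with the line `Y = y` (the roots of `X³ = y² + a₃y - a₆`), hence
`(ω²x, y) + (ωx, y) + (x, y) = O` by the chord–tangent law (for `x = 0` the point `(0, y)` is a flex:
`2(0, y) = -(0, y)`).  Computed with Mathlib's addition formulae (`slope = 0`).
[cite: SilvermanAEC2009, III.2.3] -/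
theorem _root_.WeierstrassCurve.Affine.Point.some_add_some_add_some_eq_zero_of_cube {L : Type u} [Field L]
    {V : WeierstrassCurve L} (ha₁ : V.a₁ = 0) (ha₂ : V.a₂ = 0) (ha₄ : V.a₄ = 0) (h3 : (3 : L) ≠ 0)
    {ω : L} (hω : ω ^ 2 + ω + 1 = 0) {x y : L} (h₀ : V.toAffine.Nonsingular x y)
    (h₁ : V.toAffine.Nonsingular (ω * x) y) (h₂ : V.toAffine.Nonsingular (ω * (ω * x)) y) :
    WeierstrassCurve.Affine.Point.some _ _ h₂ + WeierstrassCurve.Affine.Point.some _ _ h₁ +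
      WeierstrassCurve.Affine.Point.some _ _ h₀ = 0 := by
  by_cases hx : x = 0
  · subst hx
    -- the flex `(0, y)`: `2 (0, y) = -(0, y)`
    have hy : y ≠ V.toAffine.negY 0 y := by
      obtain ⟨-, h | h⟩ := (WeierstrassCurve.Affine.nonsingular_iff _ _).mp h₀
      · exact absurd (by rw [ha₁, ha₂, ha₄]; ring) h
      · exact h
    have e₁ : (WeierstrassCurve.Affine.Point.some _ _ h₁ : V.toAffine.Point) =
        WeierstrassCurve.Affine.Point.some _ _ h₀ := by
      simp only [mul_zero]
    have e₂ : (WeierstrassCurve.Affine.Point.some _ _ h₂ : V.toAffine.Point) =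
        WeierstrassCurve.Affine.Point.some _ _ h₀ := by
      simp only [mul_zero]
    have hs : V.toAffine.slope 0 0 y y = 0 := by
      rw [WeierstrassCurve.Affine.slope_of_Y_ne rfl hy]
      simp [ha₁, ha₄]
    have h2 : (WeierstrassCurve.Affine.Point.some _ _ h₀ : V.toAffine.Point) +
        WeierstrassCurve.Affine.Point.some _ _ h₀ = -WeierstrassCurve.Affine.Point.some _ _ h₀ := by
      rw [WeierstrassCurve.Affine.Point.add_self_of_Y_ne hy, WeierstrassCurve.Affine.Point.neg_some]
      simp only [WeierstrassCurve.Affine.Point.some.injEq]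
      refine ⟨?_, ?_⟩
      · simp [WeierstrassCurve.Affine.addX, hs, ha₁, ha₂]
      · simp [WeierstrassCurve.Affine.addY, WeierstrassCurve.Affine.addX, WeierstrassCurve.Affine.negAddY,
          WeierstrassCurve.Affine.negY, hs, ha₁, ha₂]
    rw [e₁, e₂, h2, neg_add_cancel]
  · -- generic case: the chord through `(ω²x, y)` and `(ωx, y)` is horizontal and meets `E′` again in `(x, y)`
    have hω0 : ω ≠ 0 := ne_zero_of_sq_add_self_add_one hω
    have hω1 : ω ≠ 1 := ne_one_of_sq_add_self_add_one h3 hω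
    have hx12 : ω * (ω * x) ≠ ω * x := fun h => by
      have : (ω - 1) * (ω * x) = 0 := by linear_combination h
      rcases mul_eq_zero.mp this with h' | h'
      · exact hω1 (sub_eq_zero.mp h')
      · rcases mul_eq_zero.mp h' with h'' | h''
        · exact hω0 h''
        · exact hx h''
    have hs : V.toAffine.slope (ω * (ω * x)) (ω * x) y y = 0 := by
      rw [WeierstrassCurve.Affine.slope_of_X_ne hx12, sub_self, zero_div]
    rw [WeierstrassCurve.Affine.Point.add_of_X_ne hx12]
    have h12 : (WeierstrassCurve.Affine.Point.some _ _
        (WeierstrassCurve.Affine.nonsingular_add h₂ h₁ fun hxy => hx12 hxy.left) : V.toAffine.Point) =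
        -WeierstrassCurve.Affine.Point.some _ _ h₀ := by
      rw [WeierstrassCurve.Affine.Point.neg_some]
      simp only [WeierstrassCurve.Affine.Point.some.injEq]
      refine ⟨?_, ?_⟩
      · simp only [WeierstrassCurve.Affine.addX, hs, ha₁, ha₂]
        linear_combination (-x) * hω
      · simp [WeierstrassCurve.Affine.addY, WeierstrassCurve.Affine.addX, WeierstrassCurve.Affine.negAddY,
          WeierstrassCurve.Affine.negY, hs, ha₁]
    rw [h12, neg_add_cancel]

/-! ### `[ω]` as an endomorphism of the abelian variety `E′`; `[ω]³ = 𝟙` and `[ω]² + [ω] + 𝟙 = 0` -/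

section Endomorphism

variable [Fact (IsUnit (3 : K))] {ω : K} (hω : ω ^ 2 + ω + 1 = 0)

/-- `[ω]` with source and target spelled as the scheme of the abelian variety `E′` (definitionally
`mulOmegaOver`; the spelling carries the group-scheme instance). [folklore] -/
def mulOmegaOverX : (abelianVariety K).X ⟶ (abelianVariety K).X := mulOmegaOver hω

/-- `[ω]` fixes the origin (group-scheme form). [cite: SilvermanAEC2009, III.10.1] -/
theorem one_comp_mulOmegaOverX : η[(abelianVariety K).X] ≫ mulOmegaOverX hω = η[(abelianVariety K).X] :=
  oneHom_comp_mulOmegaOver hω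

/-- `[ω]` is a homomorphism of group schemes (rigidity: it fixes the origin; Mumford §4 Cor. 1, the
tree's `isMonHom_of_one_comp`). [cite: MumfordAV1970, §4 Cor. 1] -/
instance isMonHom_mulOmegaOverX : IsMonHom (mulOmegaOverX hω) :=
  isMonHom_of_one_comp (A := abelianVariety K) (B := abelianVariety K) (mulOmegaOverX hω)
    (one_comp_mulOmegaOverX hω)

/-- **`[ω] : E′ ⟶ E′`, `(x, y) ↦ (ωx, y)`, as an endomorphism of the abelian variety `E′ : y² + y = x³`
over `K`** (`ω ∈ K`, `ω² + ω + 1 = 0`; a morphism fixing `O` is a homomorphism by rigidity).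
[cite: SilvermanAEC2009, III.10.1] [cite: MumfordAV1970, §4 Cor. 1] -/
def mulOmega : abelianVariety K ⟶ abelianVariety K :=
  InducedCategory.homMk (Grp.homMk (mulOmegaOverX hω))

/-- The underlying morphism of schemes of `[ω]` is `mulOmegaOver`, `[x : y : z] ↦ [ωx : y : z]` (`rfl`).
[cite: SilvermanAEC2009, III.10.1] -/
theorem mulOmega_hom : (mulOmega hω).hom.hom.hom = mulOmegaOver hω := rfl

/-- **`[ω] ≫ [ω] ≫ [ω] = 𝟙` on `E′ : y² + y = x³`** (`ω³ = 1`: `[ω]` is an automorphism of order `3`; checked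
on `K̄`-points, which separate morphisms out of the reduced finite-type `K`-scheme `E′`).
[cite: SilvermanAEC2009, III.10.1] [cite: Hartshorne1977, IV Example 4.20.2] [cite: MumfordAV1970, §4] -/
theorem mulOmega_comp_mulOmega_comp_mulOmega :
    (mulOmega hω ≫ mulOmega hω) ≫ mulOmega hω = 𝟙 (abelianVariety K) := by
  apply AbelianVariety.hom_ext
  haveI : IsReduced (abelianVariety K).X.left := (ofJ0 K).isReduced_scheme_left
  refine SchemeOver.hom_ext_of_forall_algPoints (AlgebraicClosure K) fun P => ?_
  obtain ⟨v, hv, hEq, rfl⟩ := (ofJ0 K).exists_eq_schemePoint P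
  rw [AbelianVariety.comp_hom, AbelianVariety.comp_hom, AbelianVariety.id_hom]
  change (((ofJ0 K).schemePoint v hv hEq ≫ mulOmegaOver hω) ≫ mulOmegaOver hω) ≫ mulOmegaOver hω =
    (ofJ0 K).schemePoint v hv hEq ≫ 𝟙 _
  rw [Category.comp_id]
  exact schemePoint_comp_mulOmegaOver_comp_mulOmegaOver_comp_mulOmegaOver hω v hv hEq

/-- `[ω] ^ 3 = 1` in the ring `End E′`. [cite: SilvermanAEC2009, III.10.1] -/
theorem mulOmega_pow_three : (show End (abelianVariety K) from mulOmega hω) ^ 3 = 1 := by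
  rw [pow_three, CategoryTheory.End.mul_def, CategoryTheory.End.mul_def, mulOmega_comp_mulOmega_comp_mulOmega]
  rfl

local notation "K̄" => AlgebraicClosure K

omit [Fact (IsUnit (3 : K))] in
/-- `y² + y = x³` keeps its coefficients under base change: `a₁ = a₂ = a₄ = 0` over `K̄`. [folklore] -/
private theorem baseChange_a₁ : ((ofJ0 K).baseChange K̄).a₁ = 0 := by
  simp [WeierstrassCurve.baseChange, WeierstrassCurve.ofJ0]

omit [Fact (IsUnit (3 : K))] in
/-- `a₂ = 0` over `K̄`. [folklore] -/
private theorem baseChange_a₂ : ((ofJ0 K).baseChange K̄).a₂ = 0 := by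
  simp [WeierstrassCurve.baseChange, WeierstrassCurve.ofJ0]

omit [Fact (IsUnit (3 : K))] in
/-- `a₄ = 0` over `K̄`. [folklore] -/
private theorem baseChange_a₄ : ((ofJ0 K).baseChange K̄).a₄ = 0 := by
  simp [WeierstrassCurve.baseChange, WeierstrassCurve.ofJ0]

/-- `3 ≠ 0` in `K̄` (from `3 ∈ Kˣ`). [folklore] -/
private theorem three_ne_zero' : (3 : K̄) ≠ 0 := by
  have h := ((Fact.out : IsUnit (3 : K)).map (algebraMap K K̄)).ne_zero
  rwa [map_ofNat] at h

omit [Fact (IsUnit (3 : K))] in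
include hω in
/-- `ω² + ω + 1 = 0` in `K̄`. [folklore] -/
private theorem sq_add_self_add_one_algebraMap :
    (algebraMap K K̄ ω) ^ 2 + algebraMap K K̄ ω + 1 = 0 := by
  have h := congrArg (algebraMap K K̄) hω
  rwa [map_add, map_add, map_pow, map_one, map_zero] at h

include hω in
/-- `(x, y) ∈ E′(K̄) ⇒ (ωx, y) ∈ E′(K̄)` (nonsingular points; `(ωx)³ = x³`). [cite: SilvermanAEC2009, III.10.1] -/
theorem nonsingular_mul {x y : K̄} (h : ((ofJ0 K).baseChange K̄).toAffine.Nonsingular x y) :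
    ((ofJ0 K).baseChange K̄).toAffine.Nonsingular (algebraMap K K̄ ω * x) y := by
  haveI : ((ofJ0 K).baseChange K̄).IsElliptic :=
    inferInstanceAs (((ofJ0 K).map (algebraMap K K̄)).IsElliptic)
  rw [← WeierstrassCurve.Affine.equation_iff_nonsingular, WeierstrassCurve.Affine.equation_iff,
    baseChange_a₁, baseChange_a₂, baseChange_a₄] at h ⊢
  have h3 : (algebraMap K K̄ ω) ^ 3 = 1 := by
    rw [← map_pow, pow_three_eq_one_of_sq_add_self_add_one hω, map_one]
  linear_combination h - x ^ 3 * h3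

/-- **`[ω](K̄)` read in `W(K̄)`: `O ↦ O`.** [cite: SilvermanAEC2009, III.10.1] -/
theorem geomPointsMap_mulOmega_ofAffinePoint_zero :
    AbelianVariety.Hom.geomPointsMap (mulOmega hω) (ofAffinePoint K 0) = ofAffinePoint K 0 := by
  apply Additive.toMul.injective
  rw [AbelianVariety.Hom.geomPointsMap_apply, toMul_ofAffinePoint]
  exact map_mulOmegaOver_pointEquiv_zero hω

/-- **`[ω](K̄)` read in `W(K̄)`: `(x, y) ↦ (ωx, y)`.** [cite: SilvermanAEC2009, III.10.1] -/
theorem geomPointsMap_mulOmega_ofAffinePoint_some {x y : K̄}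
    (h : ((ofJ0 K).baseChange K̄).toAffine.Nonsingular x y) :
    AbelianVariety.Hom.geomPointsMap (mulOmega hω) (ofAffinePoint K (WeierstrassCurve.Affine.Point.some x y h)) =
      ofAffinePoint K (WeierstrassCurve.Affine.Point.some _ _ (nonsingular_mul hω h)) := by
  apply Additive.toMul.injective
  rw [AbelianVariety.Hom.geomPointsMap_apply, toMul_ofAffinePoint]
  exact map_mulOmegaOver_pointEquiv_some hω h (nonsingular_mul hω h)

/-- **`[ω] ≫ [ω] + [ω] + 𝟙 = 0` in `End_K(E′)`** — `[ω]` is a root of `X² + X + 1 = Φ₃`, i.e.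
`ℤ[ω] → End_K(E′)`, `ω ↦ [ω]` is a ring homomorphism (Silverman App. C Example 11.3.1: `j = 0` has complex
multiplication by `ℤ[ω]`).  Unlike `[ω]³ = 𝟙` this is not an identity of substitutions: it is checked on
`K̄`-points, which separate homomorphisms (`AbelianVariety.eq_zero_of_geomPointsMap_eq_zero`, Mumford §4),
after transport through the additive dictionary `E′(K̄) ≃+ W(K̄)`, where it is the chord–tangent identity
`(ω²x, y) + (ωx, y) + (x, y) = O` (`some_add_some_add_some_eq_zero_of_cube`).
[cite: SilvermanAEC2009, III.2.3 and App. C §11 Example 11.3.1] [cite: MumfordAV1970, §4 and §19] -/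
theorem mulOmega_comp_mulOmega_add :
    mulOmega hω ≫ mulOmega hω + mulOmega hω + 𝟙 (abelianVariety K) = 0 := by
  apply AbelianVariety.eq_zero_of_geomPointsMap_eq_zero
  rw [AbelianVariety.Hom.geomPointsMap_add, AbelianVariety.Hom.geomPointsMap_add,
    AbelianVariety.Hom.geomPointsMap_comp, AbelianVariety.Hom.geomPointsMap_id]
  ext P
  obtain ⟨Q, rfl⟩ := exists_eq_ofAffinePoint K P
  apply (geomPointsEquiv K).injective
  rw [AddMonoidHom.add_apply, AddMonoidHom.add_apply, AddMonoidHom.comp_apply, AddMonoidHom.id_apply,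
    AddMonoidHom.zero_apply, AddEquiv.map_add, AddEquiv.map_add, AddEquiv.map_zero, geomPointsEquiv_ofAffinePoint]
  rcases Q with _ | ⟨x, y, h⟩
  · rw [← WeierstrassCurve.Affine.Point.zero_def, geomPointsMap_mulOmega_ofAffinePoint_zero hω,
      geomPointsMap_mulOmega_ofAffinePoint_zero hω, geomPointsEquiv_ofAffinePoint]
    exact (add_zero _).trans (add_zero _)
  · rw [geomPointsMap_mulOmega_ofAffinePoint_some hω h,
      geomPointsMap_mulOmega_ofAffinePoint_some hω (nonsingular_mul hω h),
      geomPointsEquiv_ofAffinePoint, geomPointsEquiv_ofAffinePoint]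
    exact WeierstrassCurve.Affine.Point.some_add_some_add_some_eq_zero_of_cube (baseChange_a₁ (K := K))
      (baseChange_a₂ (K := K)) (baseChange_a₄ (K := K)) (three_ne_zero' (K := K))
      (sq_add_self_add_one_algebraMap hω) h (nonsingular_mul hω h) (nonsingular_mul hω (nonsingular_mul hω h))

/-- `[ω] * [ω] + [ω] + 1 = 0` in the ring `End E′`. [cite: SilvermanAEC2009, App. C §11 Example 11.3.1] -/
theorem mulOmega_mul_mulOmega_add :
    (show End (abelianVariety K) from mulOmega hω) * (show End (abelianVariety K) from mulOmega hω) +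
      (show End (abelianVariety K) from mulOmega hω) + 1 = 0 := by
  rw [CategoryTheory.End.mul_def]
  exact mulOmega_comp_mulOmega_add hω

/-- **`[ω]² + [ω] + 1 = 0` in `End E′`**: `[ω]` is a root of `X² + X + 1 = Φ₃` («there is a ring homomorphism
`ℤ[ω] → End(E)`», the `j = 0` row of the CM table). [cite: SilvermanAEC2009, App. C §11 Example 11.3.1] -/
theorem aeval_mulOmega_X_sq_add_X_add_one :
    Polynomial.aeval (R := ℤ) (show End (abelianVariety K) from mulOmega hω)
      (Polynomial.X ^ 2 + Polynomial.X + 1 : Polynomial ℤ) = 0 := by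
  rw [map_add, map_add, map_pow, Polynomial.aeval_X, map_one, sq]
  exact mulOmega_mul_mulOmega_add hω

/-- `Φ₃([ω]) = 0` in `End E′` (`Φ₃ = X² + X + 1`, Mathlib `cyclotomic_three`). [cite: SilvermanAEC2009, App. C §11 Example 11.3.1] -/
theorem aeval_mulOmega_cyclotomic_three :
    Polynomial.aeval (R := ℤ) (show End (abelianVariety K) from mulOmega hω) (Polynomial.cyclotomic 3 ℤ) = 0 := by
  rw [Polynomial.cyclotomic_three]
  exact aeval_mulOmega_X_sq_add_X_add_one hω

/-- **`[ω] ≠ 𝟙`**: `[ω]` moves the `K̄`-point `(1, y₁)` of `E′` (`y₁² + y₁ = 1`) to `(ω, y₁) ≠ (1, y₁)`.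
[cite: SilvermanAEC2009, III.10.1] -/
theorem mulOmega_ne_id : mulOmega hω ≠ 𝟙 (abelianVariety K) := by
  intro h
  -- a point `(1, y₁)` of `E′(K̄)`: `y₁` a root of `Y² + Y - 1`
  obtain ⟨y₁, hy₁⟩ : ∃ y₁ : K̄, y₁ ^ 2 + y₁ - 1 = 0 := by
    have hdeg : (Polynomial.X ^ 2 + Polynomial.X - 1 : Polynomial K̄).degree ≠ 0 := by
      have e : (Polynomial.X ^ 2 + Polynomial.X - 1 : Polynomial K̄) =
          Polynomial.C 1 * Polynomial.X ^ 2 + Polynomial.C 1 * Polynomial.X + Polynomial.C (-1) := by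
        simp only [map_one, one_mul, map_neg, sub_eq_add_neg]
      rw [e, Polynomial.degree_quadratic one_ne_zero]
      decide
    obtain ⟨y₁, hy₁⟩ := IsAlgClosed.exists_root _ hdeg
    exact ⟨y₁, by simpa [Polynomial.IsRoot] using hy₁⟩
  haveI : ((ofJ0 K).baseChange K̄).IsElliptic :=
    inferInstanceAs (((ofJ0 K).map (algebraMap K K̄)).IsElliptic)
  have hns : ((ofJ0 K).baseChange K̄).toAffine.Nonsingular 1 y₁ := by
    rw [← WeierstrassCurve.Affine.equation_iff_nonsingular, WeierstrassCurve.Affine.equation_iff,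
      baseChange_a₁, baseChange_a₂, baseChange_a₄]
    have ha₃ : ((ofJ0 K).baseChange K̄).a₃ = 1 := by simp [WeierstrassCurve.baseChange, WeierstrassCurve.ofJ0]
    have ha₆ : ((ofJ0 K).baseChange K̄).a₆ = 0 := by simp [WeierstrassCurve.baseChange, WeierstrassCurve.ofJ0]
    rw [ha₃, ha₆]
    linear_combination hy₁
  have hP := congrArg (fun f => AbelianVariety.Hom.geomPointsMap f
    (ofAffinePoint K (WeierstrassCurve.Affine.Point.some 1 y₁ hns))) h
  simp only [AbelianVariety.Hom.geomPointsMap_id, AddMonoidHom.id_apply] at hP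
  rw [geomPointsMap_mulOmega_ofAffinePoint_some hω hns] at hP
  have hQ := (WeierstrassCurve.Affine.Point.some.injEq _ _ _ _ _ _).mp (ofAffinePoint_injective K hP)
  have hω1 : algebraMap K K̄ ω ≠ 1 := by
    rw [← map_one (algebraMap K K̄), Ne, (algebraMap K K̄).injective.eq_iff]
    exact ne_one_of_sq_add_self_add_one (Fact.out : IsUnit (3 : K)).ne_zero hω
  exact hω1 (by simpa using hQ.1)

/-- **Non-vacuity / summary: over every field `K` with `3 ∈ Kˣ` containing a primitive cube root of unity
`ω` there is a one-dimensional abelian variety over `K` with an endomorphism `u ≠ 𝟙` DEFINED OVER `K`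
with `u ≫ u ≫ u = 𝟙` and `u ≫ u + u + 𝟙 = 0`** (`E′ : y² + y = x³` with `[ω]`). [cite: SilvermanAEC2009, III.10.1] -/
theorem exists_abelianVariety_endomorphism_order_three (hK : ∃ ω : K, ω ^ 2 + ω + 1 = 0) :
    ∃ (E : AbelianVariety K) (u : E ⟶ E), E.dim = 1 ∧ u ≠ 𝟙 E ∧ (u ≫ u) ≫ u = 𝟙 E ∧ u ≫ u + u + 𝟙 E = 0 := by
  obtain ⟨ω, hω⟩ := hK
  exact ⟨abelianVariety K, mulOmega hω, dim_abelianVariety K, mulOmega_ne_id hω,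
    mulOmega_comp_mulOmega_comp_mulOmega hω, mulOmega_comp_mulOmega_add hω⟩

end Endomorphism

end J0

end Literature.NumberTheory.EllipticCurves

end
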